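/-
builds on p205010 (kernel theorem, internal audit signed; external expert review pending) — nothing in this file uses p205010.

# The PROXY TRANSPORT (WAVE-Us-MANIFEST v1.0 §2(iv) / §6(c) option (a)): an input SERVED at a proxy `c′` of a centre `c`
# (`φ c′ = φ c`, `c ∈ B_G(c′, D)`) SUPPLIES the consumer-shaped input AT `c` with every radius slot `+ D`

Design (D-s2‴) 'base-type proxies' (P3-NILPOTENT §19.12–19.14; refuter's G1–G5 PASS, p5-g24 2026-08-26): the Step-I inputs of the base type `t`
exist only at the frame images `c′` of `t`; an arbitrary centre `c` is served at its proxy `c′ = prox c` (same chart position, graph distance `≤ D`).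
Every CONSUMER family keeps its own centre `c`; this file is the one mechanism that turns the served event at `c′` into the consumer-shaped
event at `c`, by SET MONOTONICITY — no probability beyond `μ(A) ≤ μ(B)` for `A ⊆ B`:
* §1 chart-level sets read only `φ c`: `cyl`, `relCoord`, `shearCoord`, `pgramCyl` COINCIDE at `c` and `c′` (`…_eq_of_apply_eq`);
* §2 graph-metric sets grow by the proxy distance: `cylBall c′ ℓ R ⊆ cylBall c ℓ (R + D)` once `D ≤ ℓ` (`cylBall_subset_cylBall_add`, from
  `Skelφ.mem_cylBall_of_mem_graphBall`, part 4), hence `pgramPrism`, `pgSideHalfW`, `pgTopPieceW` with radius `R ↦ R + D` once `D ≤ n`;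
* §3 the Step-I realised objects: with the consumer-side data `DataN.proxR D prox Dp` (seeds re-indexed through `prox`, kit radius `+ Dp`, everything
  else unchanged) one has `regionNAt D t (prox c) ⊆ regionNAt (D.proxR prox Dp) t c`, the same for `pieceNAt`, and
  **`eventNAt D t (prox c) x ⊆ eventNAt (D.proxR prox Dp) t c x`** for every input index `x` (zones: equal; piece-links: `linkIn_mono`), so
  `μ.real (eventNAt D t (prox c) x) ≤ μ.real (eventNAt (D.proxR prox Dp) t c x)` (`measureReal_eventNAt_proxR_le`).
U (one type) is the instance `prox = id`, `Dp = 0` (`DataN.proxR_id`). Nothing about any open node (U, U_s) is claimed.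
[cite: MartineauTassion2017, §3.1–3.2 (R(a,b), L(a,u))] [cite: KozmaNitzan2024, §4 pp. 19–21 ((21)–(25): the inputs at every vertex)] [this work]
-/
import Summits.CriticalPhenomena.PercolationContinuityZ3.Theorems.Transplant.SkelPhiStepINegFrame
import Summits.CriticalPhenomena.PercolationContinuityZ3.Theorems.Transplant.PlanarSkeletonFrmScaledCoarseProxy

noncomputable section

namespace Summit.CriticalPhenomena.PercolationContinuityZ3.Theorems.Transplant

namespace Skelφ

open MeasureTheory Literature.Probability.Percolation Literature.Probability.LatticeModels SimpleGraph KNLevels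
open Literature.Barriers.CriticalPhenomena (graphBall mem_graphBall_self graphBall_mono)
open scoped Classical

variable {V : Type} {G : SimpleGraph V} {φ : V → Site 2}

/-! ## §1 Chart-level sets read only `φ c` -/

/-- Graph balls are symmetric (reverse the walk). [folklore] -/
theorem mem_graphBall_comm {x y : V} {n : ℕ} (h : y ∈ graphBall G x n) : x ∈ graphBall G y n := by
  obtain ⟨w, hw⟩ := h
  exact ⟨w.reverse, by rw [SimpleGraph.Walk.length_reverse]; exact hw⟩

/-- Cylinders read only the chart value of the centre. [folklore] -/
theorem cyl_eq_of_apply_eq {c c' : V} (h : φ c' = φ c) (ℓ : ℕ) : cyl φ c' ℓ = cyl φ c ℓ := by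
  ext w; rw [mem_cyl, mem_cyl, h]

/-- Relative coordinates read only the chart value of the centre. [folklore] -/
theorem relCoord_eq_of_apply_eq {c c' : V} (h : φ c' = φ c) (i : Fin 2) : relCoord φ c' i = relCoord φ c i := by
  funext w; simp only [relCoord, h]

/-- Shear coordinates read only the chart value of the centre. [folklore] -/
theorem shearCoord_eq_of_apply_eq {c c' : V} (h : φ c' = φ c) (n : ℕ) (hh : ℤ) : shearCoord φ c' n hh = shearCoord φ c n hh := by
  funext w; simp only [shearCoord, relCoord_eq_of_apply_eq h]

/-- Parallelogram cylinders read only the chart value of the centre. [folklore] -/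
theorem pgramCyl_eq_of_apply_eq {c c' : V} (h : φ c' = φ c) (n : ℕ) (hh : ℤ) (ℓ : ℕ) : pgramCyl φ c' n hh ℓ = pgramCyl φ c n hh ℓ := by
  ext w; simp only [mem_pgramCyl, relCoord_eq_of_apply_eq h, shearCoord_eq_of_apply_eq h]

/-! ## §2 Graph-metric sets grow by the proxy distance -/

/-- A walk of an induced graph is a walk (of the same length) of the graph induced on any larger set. [folklore] -/
theorem exists_walk_induce_mono {S T : Set V} (h : S ⊆ T) : ∀ {x y : S} (w : (G.induce S).Walk x y),
    ∃ w' : (G.induce T).Walk (Set.inclusion h x) (Set.inclusion h y), w'.length = w.length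
  | _, _, .nil => ⟨.nil, rfl⟩
  | a, _, .cons (v := b) hadj w => by
    obtain ⟨w', hw'⟩ := exists_walk_induce_mono h w
    have hadj' : (G.induce T).Adj (Set.inclusion h a) (Set.inclusion h b) :=
      SimpleGraph.induce_adj.2 (SimpleGraph.induce_adj.1 hadj)
    exact ⟨.cons hadj' w', by simp [hw']⟩

/-- **The fat prism about a proxy lies in the fat prism about the centre with radius `+ D`**: `φ c′ = φ c`, `c ∈ B_G(c′, D)`, `D ≤ ℓ`, chart
`1`-Lipschitz ⇒ `cylBall c′ ℓ R ⊆ cylBall c ℓ (R + D)` (prepend the proxy path, which stays inside the common cylinder). [this work] -/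
theorem cylBall_subset_cylBall_add (hlip : Lip G φ) {c c' : V} {D ℓ R : ℕ} (hφ : φ c' = φ c) (hc : c ∈ graphBall G c' D) (hℓ : D ≤ ℓ) :
    cylBall G φ c' ℓ R ⊆ cylBall G φ c ℓ (R + D) := by
  have hsub : cyl φ c' ℓ ≤ cyl φ c ℓ := (cyl_eq_of_apply_eq hφ ℓ).le
  have hc' : c' ∈ cylBall G φ c ℓ D := mem_cylBall_of_mem_graphBall hlip (mem_graphBall_comm hc) hℓ le_rfl
  obtain ⟨⟨x, hxT⟩, ⟨u, hu⟩, hx⟩ := hc'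
  rintro _ ⟨y, ⟨w, hw⟩, rfl⟩
  have hx' : x = c' := hx
  subst hx'
  obtain ⟨w', hw'⟩ := exists_walk_induce_mono (G := G) hsub w
  refine ⟨Set.inclusion hsub y, ⟨u.append w', ?_⟩, rfl⟩
  rw [SimpleGraph.Walk.length_append, hw']
  omega

/-- Fat parallelograms: `pgramPrism c′ n h ℓ R ⊆ pgramPrism c n h ℓ (R + D)` once `D ≤ n` (`n ≤ pgScale n h ℓ`). [this work] -/
theorem pgramPrism_subset_add (hlip : Lip G φ) {c c' : V} {D : ℕ} (hφ : φ c' = φ c) (hc : c ∈ graphBall G c' D) {n : ℕ} (hn : D ≤ n)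
    (hh : ℤ) (ℓ R : ℕ) : pgramPrism G φ c' n hh ℓ R ⊆ pgramPrism G φ c n hh ℓ (R + D) := by
  intro w hw
  rw [mem_pgramPrism] at hw ⊢
  exact ⟨cylBall_subset_cylBall_add hlip hφ hc (hn.trans (le_max_left _ _)) hw.1, pgramCyl_eq_of_apply_eq hφ n hh ℓ ▸ hw.2⟩

/-- Side halves: `pgSideHalfW c′ n h ℓ R σ τ ⊆ pgSideHalfW c n h ℓ (R + D) σ τ` once `D ≤ n`. [this work] -/
theorem pgSideHalfW_subset_add [G.LocallyFinite] (hlip : Lip G φ) {c c' : V} {D : ℕ} (hφ : φ c' = φ c) (hc : c ∈ graphBall G c' D) {n : ℕ}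
    (hn : D ≤ n) (hh : ℤ) (ℓ R : ℕ) (σ τ : ℤ) : pgSideHalfW G φ c' n hh ℓ R σ τ ⊆ pgSideHalfW G φ c n hh ℓ (R + D) σ τ := by
  intro w hw
  rw [mem_pgSideHalfW] at hw ⊢
  obtain ⟨h1, h2, h3, h4⟩ := hw
  exact ⟨pgramPrism_subset_add hlip hφ hc hn hh (3 * ℓ) R h1, pgramCyl_eq_of_apply_eq hφ n hh ℓ ▸ h2,
    relCoord_eq_of_apply_eq hφ 0 ▸ h3, shearCoord_eq_of_apply_eq hφ n hh ▸ h4⟩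

/-- Top/bottom pieces: `pgTopPieceW c′ … R σ τ v ⊆ pgTopPieceW c … (R + D) σ τ v` once `D ≤ n`. [this work] -/
theorem pgTopPieceW_subset_add [G.LocallyFinite] (hlip : Lip G φ) {c c' : V} {D : ℕ} (hφ : φ c' = φ c) (hc : c ∈ graphBall G c' D) {n : ℕ}
    (hn : D ≤ n) (hh : ℤ) (ℓ R : ℕ) (σ τ v : ℤ) : pgTopPieceW G φ c' n hh ℓ R σ τ v ⊆ pgTopPieceW G φ c n hh ℓ (R + D) σ τ v := by
  intro w hw
  rw [mem_pgTopPieceW] at hw ⊢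
  obtain ⟨h1, h2, h3, h4⟩ := hw
  exact ⟨pgramPrism_subset_add hlip hφ hc hn hh (3 * ℓ) R h1, pgramCyl_eq_of_apply_eq hφ n hh ℓ ▸ h2,
    shearCoord_eq_of_apply_eq hφ n hh ▸ h3, relCoord_eq_of_apply_eq hφ 0 ▸ h4⟩

/-! ## §3 The Step-I realised objects under the consumer-side data `DataN.proxR` -/

namespace StepI

/-- **Consumer-side data**: the seeds re-indexed through the proxy map (`Λ′ c := Λ (prox c)`) and the kit radius enlarged by the proxy distance
(`R′ s := R s + Dp`); every other field unchanged. [this work] -/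
def DataN.proxR (D : DataN V) (prox : V → V) (Dp : ℕ) : DataN V :=
  { D with Λ := fun c => D.Λ (prox c), R := fun s => D.R s + Dp }

/-- Seeds of `proxR`. [folklore] -/
@[simp] theorem DataN.proxR_Λ (D : DataN V) (prox : V → V) (Dp : ℕ) (c : V) : (D.proxR prox Dp).Λ c = D.Λ (prox c) := rfl

/-- Radii of `proxR`. [folklore] -/
@[simp] theorem DataN.proxR_R (D : DataN V) (prox : V → V) (Dp : ℕ) (s : ℕ) : (D.proxR prox Dp).R s = D.R s + Dp := rfl

/-- Seed level of `proxR`. [folklore] -/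
@[simp] theorem DataN.proxR_k (D : DataN V) (prox : V → V) (Dp : ℕ) : (D.proxR prox Dp).k = D.k := rfl

/-- Shears of `proxR`. [folklore] -/
@[simp] theorem DataN.proxR_hgt (D : DataN V) (prox : V → V) (Dp : ℕ) : (D.proxR prox Dp).hgt = D.hgt := rfl

/-- Half-lengths of `proxR`. [folklore] -/
@[simp] theorem DataN.proxR_len (D : DataN V) (prox : V → V) (Dp : ℕ) : (D.proxR prox Dp).len = D.len := rfl

/-- Split points of `proxR`. [folklore] -/
@[simp] theorem DataN.proxR_spl (D : DataN V) (prox : V → V) (Dp : ℕ) : (D.proxR prox Dp).spl = D.spl := rfl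

/-- Scales of `proxR`. [folklore] -/
@[simp] theorem DataN.proxR_scale (D : DataN V) (prox : V → V) (Dp : ℕ) (t : V) (M n : ℕ) :
    (D.proxR prox Dp).scale t M n = D.scale t M n := rfl

/-- **U is the instance `prox = id`, `Dp = 0`.** [folklore] -/
theorem DataN.proxR_id (D : DataN V) : D.proxR id 0 = D := rfl

variable [G.LocallyFinite] (hlip : Lip G φ) {prox : V → V} {Dp : ℕ} {c : V} (hφ : φ (prox c) = φ c) (hc : c ∈ graphBall G (prox c) Dp)
include hlip hφ hc

/-- Link regions: served at the proxy ⊆ consumer-shaped at the centre (`Dp ≤ n`). [this work] -/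
theorem regionNAt_subset_proxR (D : DataN V) (t : V) (M : ℕ) {n : ℕ} (hn : Dp ≤ n) :
    regionNAt G φ D t (prox c) M n ⊆ regionNAt G φ (D.proxR prox Dp) t c M n := by
  unfold regionNAt
  exact pgramPrism_subset_add hlip hφ hc hn _ _ _

/-- Pieces: served at the proxy ⊆ consumer-shaped at the centre (`Dp ≤ n`). [this work] -/
theorem pieceNAt_subset_proxR (D : DataN V) (t : V) (M : ℕ) {n : ℕ} (hn : Dp ≤ n) (fam : Fin 2) (σ τ : ℤˣ) :
    pieceNAt G φ D t (prox c) M n fam σ τ ⊆ pieceNAt G φ (D.proxR prox Dp) t c M n fam σ τ := by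
  unfold pieceNAt
  split_ifs
  · exact pgSideHalfW_subset_add hlip hφ hc hn _ _ _ _ _
  · exact pgTopPieceW_subset_add hlip hφ hc hn _ _ _ _ _ _

/-- **THE TRANSPORT**: every input event served at the proxy is contained in the consumer-shaped input event at the centre — zones are EQUAL
(`(D.proxR).Λ c = D.Λ (prox c)`), piece-links by `linkIn_mono` (region and piece grow, seed equal); `Dp ≤ n` for piece-links. [this work] -/
theorem eventNAt_subset_proxR (D : DataN V) (t : V) :
    ∀ x : ℕ × Option (ℕ × Fin 2 × ℤˣ × ℤˣ), (∀ M n fam σ τ, x = (M, some (n, fam, σ, τ)) → Dp ≤ n) →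
      eventNAt G φ D t (prox c) x ⊆ eventNAt G φ (D.proxR prox Dp) t c x
  | (M, none), _ => by rw [eventNAt_none, eventNAt_none]; exact le_rfl
  | (M, some (n, fam, σ, τ)), hn => by
    rw [eventNAt_some, eventNAt_some]
    exact linkIn_mono (regionNAt_subset_proxR hlip hφ hc D t M (hn M n fam σ τ rfl)) le_rfl
      (pieceNAt_subset_proxR hlip hφ hc D t M (hn M n fam σ τ rfl) fam σ τ)

omit hlip hφ hc in
/-- The zone input: served at the proxy = consumer-shaped at the centre (no width condition). [folklore] -/
theorem eventNAt_none_proxR (D : DataN V) (t : V) (M : ℕ) :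
    eventNAt G φ D t (prox c) (M, none) = eventNAt G φ (D.proxR prox Dp) t c (M, none) := by
  rw [eventNAt_none, eventNAt_none]; rfl

/-- The piece-link input: served at the proxy ⊆ consumer-shaped at the centre (`Dp ≤ n`). [this work] -/
theorem eventNAt_some_subset_proxR (D : DataN V) (t : V) (M : ℕ) {n : ℕ} (hn : Dp ≤ n) (fam : Fin 2) (σ τ : ℤˣ) :
    eventNAt G φ D t (prox c) (M, some (n, fam, σ, τ)) ⊆ eventNAt G φ (D.proxR prox Dp) t c (M, some (n, fam, σ, τ)) := by
  rw [eventNAt_some, eventNAt_some]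
  exact linkIn_mono (regionNAt_subset_proxR hlip hφ hc D t M hn) le_rfl (pieceNAt_subset_proxR hlip hφ hc D t M hn fam σ τ)

/-- **Probabilities transport**: a lower bound served at the proxy is a lower bound for the consumer-shaped input at the centre (any finite
measure; `Dp ≤ n`). [this work] -/
theorem measureReal_eventNAt_some_proxR_le (μ : Measure (BondConfig V)) [IsFiniteMeasure μ] (D : DataN V) (t : V) (M : ℕ) {n : ℕ}
    (hn : Dp ≤ n) (fam : Fin 2) (σ τ : ℤˣ) :
    μ.real (eventNAt G φ D t (prox c) (M, some (n, fam, σ, τ))) ≤ μ.real (eventNAt G φ (D.proxR prox Dp) t c (M, some (n, fam, σ, τ))) :=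
  measureReal_mono (eventNAt_some_subset_proxR hlip hφ hc D t M hn fam σ τ)

end StepI

end Skelφ

end Summit.CriticalPhenomena.PercolationContinuityZ3.Theorems.Transplant
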